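import Mathlib
import Summits.ValiantsHypothesis.ValiantsHypothesis.Theses.OneNatPerBit
import Summits.ValiantsHypothesis.ValiantsHypothesis.Theses.FreeFermionCLL
import Summits.ValiantsHypothesis.ValiantsHypothesis.Theorems.FreeFermionCLLExpImpliesGap
import Literature.Computability.AlgebraicComplexity.PermanentCorrelation

/-!
# `CorrelationGap` split along the Valiant–Skyum–Berkowitz–Rackoff seam

Route `ValiantsHypothesis/OneNatPerBit`, deciding crux `CorrelationGap` (item
`stmt-ValiantsHypothesis-10315`): for every `c`, eventually in `n`, every fan-in-two circuit `P`
over `ℂ` with `≤ n^c` gates has `2·|permMass(P.eval)|² ≤ n!·coeffNormSq(P.eval)`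
(squared cosine with `per_n` in coefficient space `≤ 1/2`).

This file proves the ASSEMBLY of the typed decomposition
`QpPrincipalMinorForm → ExpRankLaw → CorrelationGap` (crux-strategist, BC2 redirect):

* `QpPrincipalMinorForm` (piece 1, a theorem of the literature, provable from the tree): the
  degree-`n` homogeneous component of the output of a size-`n^c` fan-in-two circuit is, up to a
  scalar, the degree-`n` component of a principal-minor form `det(I_R + diag(x∘κ)·K)` of
  quasi-polynomial total rank `R ≤ 2^((log₂ n + C)^C)` — Valiant–Skyum–Berkowitz–Rackoff /
  BCS 1997 Thm. (21.36) with Thm. (21.27) (in tree: `SLP.homogenize`, `hasInvRepr_aval`,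
  `determinantalComplexity_le_two_pow`), then the shift to a non-root and the
  Weinstein–Aronszajn/Sylvester normal form (in tree for `per_n`: `FreeFermionCLLTotalRankLeDc`).
* `ExpRankLaw` (piece 2, open; the rank-3 crux of the sibling route `FreeFermionCLL`,
  item `stmt-ValiantsHypothesis-13557`, shared verbatim): `|permMass(P^(n))|² ≤
  C·(R + n + 1)^C·θⁿ·n!·coeffNormSq(P^(n))` for every principal-minor form of total rank `R`.

Proof of the assembly: `ExpRankLaw` gives `PMCorrelationGap` (landed
`FreeFermionCLL.expImpliesGap_proof`: exponential decay beats quasi-polynomial rank); the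
functional only sees the degree-`n` component (`permMass_homogeneousComponent`: permutation
monomials have degree `n`; `coeffNormSq_homogeneousComponent_le`: dropping monomials only lowers the
denominator) and is homogeneous of degree two under scalars (`permMass_C_mul`, `coeffNormSq_C_mul`),
so the gap for the principal-minor component transfers to `P.eval`.
-/

-- single-conjunct layout: Sub = Summit, duplicated namespace component intended
set_option linter.dupNamespace false

namespace Summit.ValiantsHypothesis.ValiantsHypothesis.Theorems.OneNatPerBitCorrelationGapSplit

open MvPolynomial Literature.Computability.AlgebraicComplexity
open scoped Matrix BigOperators

/-- A permutation monomial `∏_i X_{(ρ i, i)}` has degree `n` (one variable in each row,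
`rowCount_permMonomial`). [folklore] -/
theorem degree_permMonomial {n : ℕ} (ρ : Equiv.Perm (Fin n)) : (permMonomial ρ).degree = n := by
  rw [Finsupp.degree_eq_sum, Fintype.sum_prod_type]
  have h : ∀ r : Fin n, ∑ c, permMonomial ρ (r, c) = 1 := fun r => rowCount_permMonomial ρ r
  simp_rw [h]
  simp

/-- The permutation mass only sees the degree-`n` homogeneous component:
`permMass n f^(n) = permMass n f`. [folklore] -/
theorem permMass_homogeneousComponent {n : ℕ} (f : MvPolynomial (Fin n × Fin n) ℂ) :
    permMass n (homogeneousComponent n f) = permMass n f := by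
  rw [permMass_def, permMass_def]
  refine Finset.sum_congr rfl fun σ _ => ?_
  rw [coeff_homogeneousComponent, if_pos (degree_permMonomial σ)]

/-- Passing to the degree-`n` component only removes monomials:
`coeffNormSq n f^(n) ≤ coeffNormSq n f`. [folklore] -/
theorem coeffNormSq_homogeneousComponent_le {n : ℕ} (f : MvPolynomial (Fin n × Fin n) ℂ) :
    coeffNormSq n (homogeneousComponent n f) ≤ coeffNormSq n f := by
  rw [coeffNormSq_def, coeffNormSq_def]
  have hcoeff : ∀ m ∈ (homogeneousComponent n f).support,
      coeff m (homogeneousComponent n f) = coeff m f := by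
    intro m hm
    rw [mem_support_iff, coeff_homogeneousComponent] at hm
    rw [coeff_homogeneousComponent]
    by_cases h : m.degree = n
    · rw [if_pos h]
    · rw [if_neg h] at hm
      exact absurd rfl hm
  have hsub : (homogeneousComponent n f).support ⊆ f.support := by
    intro m hm
    have hc := hcoeff m hm
    rw [mem_support_iff] at hm ⊢
    rwa [hc] at hm
  calc ∑ m ∈ (homogeneousComponent n f).support, ‖coeff m (homogeneousComponent n f)‖ ^ 2
        = ∑ m ∈ (homogeneousComponent n f).support, ‖coeff m f‖ ^ 2 :=
          Finset.sum_congr rfl fun m hm => by rw [hcoeff m hm]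
    _ ≤ ∑ m ∈ f.support, ‖coeff m f‖ ^ 2 :=
          Finset.sum_le_sum_of_subset_of_nonneg hsub fun m _ _ => sq_nonneg _

/-- `coeffNormSq n (C s * f) = ‖s‖² · coeffNormSq n f`. [folklore] -/
theorem coeffNormSq_C_mul {n : ℕ} (s : ℂ) (f : MvPolynomial (Fin n × Fin n) ℂ) :
    coeffNormSq n (C s * f) = ‖s‖ ^ 2 * coeffNormSq n f := by
  rw [C_mul', coeffNormSq_smul]

/-- **Assembly of the split of `CorrelationGap`** (crux-strategist, route `OneNatPerBit`):
`QpPrincipalMinorForm → ExpRankLaw → CorrelationGap`.  The first hypothesis is spelled out (it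
is the body of the route's child item `QpPrincipalMinorForm`, filed with this split); the second is
the shared item `FreeFermionCLL.ExpRankLaw` (`stmt-ValiantsHypothesis-13557`) by name; the
conclusion is the route decl itself. -/
theorem CorrelationGap_of_subs
    (h₁ : ∀ c : ℕ, ∃ C n₀ : ℕ, ∀ n ≥ n₀,
      ∀ P : Literature.Computability.AlgebraicComplexity.ArithCircuit ℂ (Fin n × Fin n),
        P.IsFanInTwo → P.size ≤ n ^ c →
          ∃ R ≤ 2 ^ ((Nat.log 2 n + C) ^ C), ∃ (K : Matrix (Fin R) (Fin R) ℂ)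
            (κ : Fin R → Fin n × Fin n) (s : ℂ),
              MvPolynomial.homogeneousComponent n P.eval =
                MvPolynomial.C s * MvPolynomial.homogeneousComponent n
                  (1 + Matrix.diagonal (fun i => MvPolynomial.X (κ i)) *
                    K.map (fun a : ℂ => (MvPolynomial.C a : MvPolynomial (Fin n × Fin n) ℂ))).det)
    (h₂ : Summit.ValiantsHypothesis.ValiantsHypothesis.Theses.FreeFermionCLL.ExpRankLaw) :
    Summit.ValiantsHypothesis.ValiantsHypothesis.Theses.OneNatPerBit.CorrelationGap := by
  -- exponential decay beats quasi-polynomial total rank (landed support of FreeFermionCLL)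
  have hGap : Theses.FreeFermionCLL.PMCorrelationGap := FreeFermionCLL.expImpliesGap_proof h₂
  intro c
  obtain ⟨C, n₁, hred⟩ := h₁ c
  obtain ⟨n₂, hgap⟩ := hGap C
  refine ⟨max n₁ n₂, fun n hn P hfan hsize => ?_⟩
  obtain ⟨R, hR, K, κ, s, hEq⟩ := hred n ((le_max_left _ _).trans hn) P hfan hsize
  have hineq := hgap n ((le_max_right _ _).trans hn) R hR K κ
  -- the principal-minor component delivered by the normal form
  set H : MvPolynomial (Fin n × Fin n) ℂ := MvPolynomial.homogeneousComponent n
    (1 + Matrix.diagonal (fun i => MvPolynomial.X (κ i)) *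
      K.map (fun a : ℂ => (MvPolynomial.C a : MvPolynomial (Fin n × Fin n) ℂ))).det with hH
  -- the target, in the vocabulary of `PermanentCorrelation.lean` (definitional)
  change 2 * ‖permMass n P.eval‖ ^ 2 ≤ (n.factorial : ℝ) * coeffNormSq n P.eval
  -- numerator: only the degree-n component counts, and it is `s · permMass H`
  have hpm : permMass n P.eval = s * permMass n H := by
    rw [← permMass_homogeneousComponent P.eval, hEq, permMass_C_mul]
  -- denominator: dropping the other components only lowers it
  have hcn : (n.factorial : ℝ) * coeffNormSq n (MvPolynomial.C s * H) ≤
      (n.factorial : ℝ) * coeffNormSq n P.eval := by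
    rw [← hEq]
    exact mul_le_mul_of_nonneg_left (coeffNormSq_homogeneousComponent_le _) (Nat.cast_nonneg _)
  rw [hpm, norm_mul, mul_pow]
  calc 2 * (‖s‖ ^ 2 * ‖permMass n H‖ ^ 2) = ‖s‖ ^ 2 * (2 * ‖permMass n H‖ ^ 2) := by ring
    _ ≤ ‖s‖ ^ 2 * ((n.factorial : ℝ) * coeffNormSq n H) :=
        mul_le_mul_of_nonneg_left hineq (sq_nonneg _)
    _ = (n.factorial : ℝ) * coeffNormSq n (MvPolynomial.C s * H) := by rw [coeffNormSq_C_mul]; ring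
    _ ≤ (n.factorial : ℝ) * coeffNormSq n P.eval := hcn

end Summit.ValiantsHypothesis.ValiantsHypothesis.Theorems.OneNatPerBitCorrelationGapSplit
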